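import Literature.Probability.RandomPlanarGeometry.BDGS2012GrahamSRWMax
import Literature.Barriers.CriticalPhenomena.LaceExpansionSAWDiagrams
import Mathlib.Data.Fin.Tuple.NatAntidiagonal
import HarnessLib

/-!
# Graham's Borel-type bound for `z_c(d)` (BDGS 2012, (1.20)), V: lace graphs with prescribed
# piece lengths — the combinatorial core of Lemma 7

Sibling file of `Literature.Probability.RandomPlanarGeometry.BDGS2012` (fact
`BDGS2012_Graham_criticalPoint_bound` = Graham 2010, Theorem 1), sequel to
`BDGS2012GrahamSRWMax.lean`. Graham's **Lemma 7** bounds the number `π̂_a^{(N)}(0;τ)` of lace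
graphs of type `N` and length `a` by a coefficient of the `N`-th power of a one-loop generating
function: "`π̂_a^{(N)}(0;τ) ≤ [β^a](F_β^τ)^N`", "`F_β^τ = Σ_{k=1}^{τ} β^k sup_x k c_k^{(0)}(x)`"
(§5; "The diagrammatic estimates … imply" it). The mechanism is sequential: a lace graph of
type `N` is built from `N` pieces `ρ_0, …, ρ_{N-1}` of lengths `k_0, …, k_{N-1}`, `ρ_0` a loop at
the origin and `ρ_i` a walk from the end of `ρ_{i-1}` to one of the `k_{i-1} + 1` sites of
`ρ_{i-1}`; forgetting all self-avoidance, there are at most `c_{k_0}^{(0)}(0)` choices for `ρ_0`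
and at most `(k_{i-1} + 1) · sup_x c_{k_i}^{(0)}(x)` for `ρ_i`. This file proves exactly that
statement for the tree's lace graphs — the first-hitting-time diagrams
`SAWLace.IsDiag σ M`, `T_M = a` of `Literature/Barriers/CriticalPhenomena/LaceExpansionSAWIdentity.lean`
(Slade 2006, §3.1; type `N = M + 1`), whose pieces are `ρ_i = ω[T_{i-1}, T_i]` with `ω(T_i)`
on `ρ_{i-1}` — using the splitting principle `SAWLace.card_filter_le_sum_append` of
`LaceExpansionSAWDiagrams.lean`.

## What is formalised (namespace `Literature.Probability.RandomPlanarGeometry.SAW.Zd.Graham2010`)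

* `profSet d a M t` — the `a`-step diagrams of order `M + 1` with prescribed lace times
  `T_i = t i` (`i ≤ M`); `prevT t i = t (i-1)` (`0` for `i = 0`), so that `ρ_i` has length
  `t i - prevT t i`;
* **`card_profSet_le`** — for any `Q` with `c_k^{(0)}(x) ≤ Q k` for all `k, x`:
  `#profSet ≤ c_{t₀}^{(0)}(0) · ∏_{i<M} (t i + 1 - prevT t i) · Q (t (i+1) - t i)` (induction on
  `M`, cutting off the last piece at `T_M`);
* the piece-length profile `pieceLen σ : Fin (M+1) → ℕ` of a diagram (`k_i = T_i - T_{i-1}`),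
  `sum_pieceLen` (`Σ k_i = T_M`), `laceTime_eq_partialSum` (`T_i = k_0 + ⋯ + k_i`), and
  **`diagTotal_le_sum_antidiagonalTuple`**:
  `Σ_x π_a^{(M+1)}(x) ≤ Σ_{k_0+⋯+k_M = a} c_{k_0}^{(0)}(0) ∏_{i<M} (k_i + 1) Q(k_{i+1})`
  — Lemma 7 with the coefficient extraction `[β^a](⋯)^N` written as the sum over compositions;
* `one_le_pieceLen` (every piece has positive length), `sum_antidiagonalTuple_prod_eq_cpow`
  (`Σ_{k_0+⋯+k_N = a} ∏ g(k_i) = cpow g (N+1) a`, the coefficient `[s^a]G^{N+1}` of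
  `BDGS2012GrahamReversion.lean`), the classes `diagTotalLe d a M K` / `diagTotalGt d a M K`
  (all pieces `≤ K` / some piece `> K`, `diagTotal_eq_add`), and
  **`diagTotalLe_mul_pow_le_cpow`**: for `z ≥ 0`, `z^a · diagTotalLe d a M K ≤ cpow f (M+1) a`
  with `f k = (k+1) Q(k) z^k` for `1 ≤ k ≤ K`, `0` otherwise — Lemma 7 verbatim up to `k ↦ k + 1`
  (a piece of length `k` has `k + 1` sites), the bound `c_{k_0}^{(0)}(0) ≤ Q(k_0)` for the first
  loop, and the truncation `k ≤ K` in place of the memory `τ`.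

Not here: the choice of `Q` (the maximum principle of `BDGS2012GrahamSRWMax.lean`) and the
generating-function estimates of §5–§6 that turn this into the bound on `A₃`.
-/

noncomputable section

open Finset
open Literature.Probability.LatticeModels Literature.Probability.LatticeModels.SRW
open Literature.Barriers.CriticalPhenomena.SAWLace
open scoped BigOperators

namespace Literature.Probability.RandomPlanarGeometry.SAW.Zd.Graham2010

variable {d : ℕ}

/-! ### Diagrams with prescribed lace times -/

open Classical in
/-- The `a`-step diagrams of order `M + 1` whose lace times are `T_i = t i` for `i ≤ M`.
[cite: Slade2006LaceExpansion, §3.1] -/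
def profSet (d a M : ℕ) (t : ℕ → ℕ) : Finset (StepSeq d a) :=
  Finset.univ.filter fun σ => IsDiag σ M ∧ ∀ i ≤ M, laceTime σ i = t i

/-- `prevT t i = t (i - 1)` (`= 0` for `i = 0`): the starting time `T_{i-1}` of the piece `ρ_i`.
[cite: Slade2006LaceExpansion, §3.1] -/
def prevT (t : ℕ → ℕ) (i : ℕ) : ℕ := if i = 0 then 0 else t (i - 1)

/-- `prevT t 0 = 0`. [folklore] -/
@[simp] theorem prevT_zero (t : ℕ → ℕ) : prevT t 0 = 0 := rfl

/-- `prevT t (i+1) = t i`. [folklore] -/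
@[simp] theorem prevT_succ (t : ℕ → ℕ) (i : ℕ) : prevT t (i + 1) = t i := rfl

/-- In a diagram with lace times `t`, the piece `ρ_M` starts at `laceStart σ M = prevT t M`.
[folklore] -/
theorem laceStart_eq_prevT {a M : ℕ} {σ : StepSeq d a} {t : ℕ → ℕ}
    (ht : ∀ i ≤ M, laceTime σ i = t i) : laceStart σ M = prevT t M := by
  rcases M with _ | M
  · rfl
  · rw [laceStart_succ, prevT_succ, ht M (Nat.le_succ M)]

/-- The number of `k`-step walks ending on one of the sites `y s`, `s ∈ [lo, m]`, is at most
`(m + 1 - lo) · Q k` when `c_k^{(0)}(x) ≤ Q k` for all `x`. [folklore] -/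
theorem card_filter_exists_endpoint_le {Q : ℕ → ℕ} (hQ : ∀ k (x : Site d), SRW.count d k x ≤ Q k)
    (k lo m : ℕ) (y : ℕ → Site d)
    [DecidablePred fun σ₂ : StepSeq d k => ∃ s ∈ Finset.Icc lo m, pos σ₂ k = y s] :
    (Finset.univ.filter fun σ₂ : StepSeq d k => ∃ s ∈ Finset.Icc lo m, pos σ₂ k = y s).card ≤
      (m + 1 - lo) * Q k := by
  classical
  have hsub : (Finset.univ.filter fun σ₂ : StepSeq d k => ∃ s ∈ Finset.Icc lo m, pos σ₂ k = y s) ⊆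
      (Finset.Icc lo m).biUnion fun s => Finset.univ.filter fun σ₂ : StepSeq d k => endpoint σ₂ = y s := by
    intro σ₂ hσ₂
    rw [Finset.mem_filter] at hσ₂
    obtain ⟨s, hs, hpos⟩ := hσ₂.2
    rw [Finset.mem_biUnion]
    refine ⟨s, hs, ?_⟩
    rw [Finset.mem_filter]
    exact ⟨Finset.mem_univ _, by rw [← pos_eq_endpoint, hpos]⟩
  calc (Finset.univ.filter fun σ₂ : StepSeq d k => ∃ s ∈ Finset.Icc lo m, pos σ₂ k = y s).card
      ≤ ((Finset.Icc lo m).biUnion fun s =>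
          Finset.univ.filter fun σ₂ : StepSeq d k => endpoint σ₂ = y s).card := Finset.card_le_card hsub
    _ ≤ ∑ s ∈ Finset.Icc lo m, (Finset.univ.filter fun σ₂ : StepSeq d k => endpoint σ₂ = y s).card :=
        Finset.card_biUnion_le
    _ ≤ ∑ _s ∈ Finset.Icc lo m, Q k := Finset.sum_le_sum fun s _ => hQ k (y s)
    _ = (m + 1 - lo) * Q k := by rw [Finset.sum_const, Nat.card_Icc, smul_eq_mul]

/-- **The sequential bound** (the mechanism of Graham's Lemma 7): for any `Q` with
`c_k^{(0)}(x) ≤ Q k`, the number of `a`-step diagrams of order `M + 1` with lace times `t`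
(`t M = a`) is at most `c_{t 0}^{(0)}(0) · ∏_{i<M} (t i + 1 - prevT t i) · Q (t (i+1) - t i)`:
`ρ_0` is a closed walk of length `t 0`, and `ρ_{i+1}`, of length `t (i+1) - t i`, ends on one of
the `t i + 1 - prevT t i` sites of `ρ_i`. [cite: Graham2010, Lemma 7] -/
theorem card_profSet_le {Q : ℕ → ℕ} (hQ : ∀ k (x : Site d), SRW.count d k x ≤ Q k) (t : ℕ → ℕ) :
    ∀ (M a : ℕ), t M = a →
      (profSet d a M t).card ≤ SRW.count d (t 0) 0 *
        ∏ i ∈ Finset.range M, ((t i + 1 - prevT t i) * Q (t (i + 1) - t i)) := by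
  classical
  intro M
  induction M with
  | zero =>
    intro a hta
    subst hta
    rw [Finset.range_zero, Finset.prod_empty, mul_one]
    unfold profSet SRW.count
    refine Finset.card_le_card fun σ hσ => ?_
    rw [Finset.mem_filter] at hσ ⊢
    obtain ⟨-, hD, hT⟩ := hσ
    have hT0 : laceTime σ 0 = t 0 := hT 0 le_rfl
    have hle : laceTime σ 0 ≤ t 0 := hT0.le
    obtain ⟨-, hmem⟩ := laceTime_spec hle
    rw [pieceSet_zero, Set.mem_singleton_iff, hT0, pos_eq_endpoint] at hmem
    exact ⟨Finset.mem_univ _, hmem⟩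
  | succ M ih =>
    intro a hta
    -- `T_M = m ≤ a = T_{M+1}`; otherwise the set is empty
    set m := t M with hm
    by_cases hma : m ≤ a
    swap
    · have : profSet d a (M + 1) t = ∅ := by
        unfold profSet
        refine Finset.filter_eq_empty_iff.2 ?_
        rintro σ - ⟨hD, hT⟩
        have h1 : laceTime σ M ≤ laceTime σ (M + 1) := laceTime_le_succ σ M
        rw [hT M (Nat.le_succ M), hT (M + 1) le_rfl, hta] at h1
        exact hma h1
      rw [this, Finset.card_empty]
      exact Nat.zero_le _
    obtain ⟨k, rfl⟩ := Nat.exists_eq_add_of_le hma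
    -- split at time `m = T_M`
    have hsplit := card_filter_le_sum_append (d := d) (m := m) (k := k)
      (fun σ => IsDiag σ (M + 1) ∧ ∀ i ≤ M + 1, laceTime σ i = t i)
      (fun σ₁ => IsDiag σ₁ M ∧ ∀ i ≤ M, laceTime σ₁ i = t i)
      (fun σ₁ σ₂ => ∃ s ∈ Finset.Icc (prevT t M) m, pos σ₂ k = pos σ₁ s - pos σ₁ m) ?_
    · refine (le_of_eq (by unfold profSet; rfl)).trans (hsplit.trans ?_)
      -- bound the inner counts uniformly and use the induction hypothesis
      calc ∑ σ₁ : StepSeq d m, (if IsDiag σ₁ M ∧ ∀ i ≤ M, laceTime σ₁ i = t i then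
            (Finset.univ.filter fun σ₂ : StepSeq d k =>
              ∃ s ∈ Finset.Icc (prevT t M) m, pos σ₂ k = pos σ₁ s - pos σ₁ m).card else 0)
          ≤ ∑ σ₁ : StepSeq d m, (if IsDiag σ₁ M ∧ ∀ i ≤ M, laceTime σ₁ i = t i then
              (m + 1 - prevT t M) * Q k else 0) := by
            refine Finset.sum_le_sum fun σ₁ _ => ?_
            split_ifs
            · exact card_filter_exists_endpoint_le hQ k (prevT t M) m (fun s => pos σ₁ s - pos σ₁ m)
            · exact le_rfl
        _ = (profSet d m M t).card * ((m + 1 - prevT t M) * Q k) := by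
            rw [← Finset.sum_filter, Finset.sum_const, smul_eq_mul]
            rfl
        _ ≤ (SRW.count d (t 0) 0 * ∏ i ∈ Finset.range M, ((t i + 1 - prevT t i) * Q (t (i + 1) - t i))) *
              ((m + 1 - prevT t M) * Q k) := Nat.mul_le_mul_right _ (ih m rfl)
        _ = SRW.count d (t 0) 0 *
              ∏ i ∈ Finset.range (M + 1), ((t i + 1 - prevT t i) * Q (t (i + 1) - t i)) := by
            rw [Finset.prod_range_succ, hta, Nat.add_sub_cancel_left, ← hm, mul_assoc]
    · -- the splitting hypothesis
      rintro σ₁ σ₂ ⟨hD, hT⟩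
      have hTM : laceTime (Fin.append σ₁ σ₂) M = m := hT M (Nat.le_succ M)
      have hDM : IsDiag σ₁ M ∧ laceTime σ₁ M = m := (isDiag_append_iff σ₁ σ₂).1 ⟨hD.mono, hTM⟩
      have hpos : ∀ s ≤ m, pos (Fin.append σ₁ σ₂) s = pos σ₁ s := fun s hs => pos_append_of_le _ _ hs
      have htimes : ∀ i ≤ M, laceTime σ₁ i = t i := by
        intro i hi
        rw [laceTime_congr (Nat.le_add_right m k) le_rfl (fun s hs => (hpos s hs).symm) hTM.le hi]
        exact hT i (Nat.le_succ_of_le hi)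
      refine ⟨⟨hDM.1, htimes⟩, ?_⟩
      -- the end of `ρ_{M+1}` lies on `ρ_M = ω[prevT t M, m]`
      have hTa : laceTime (Fin.append σ₁ σ₂) (M + 1) = m + k := (hT (M + 1) le_rfl).trans hta
      obtain ⟨-, s, hs, heq⟩ := laceTime_spec hTa.le
      simp only [prevLo_succ, laceStart_succ] at hs
      rw [Set.mem_Icc] at hs
      have hstart : laceStart (Fin.append σ₁ σ₂) M = prevT t M :=
        laceStart_eq_prevT fun i hi => hT i (Nat.le_succ_of_le hi)
      rw [hstart, hTM] at hs
      refine ⟨s, Finset.mem_Icc.2 ⟨hs.1, hs.2⟩, ?_⟩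
      rw [hTa, pos_append_add, hpos s hs.2] at heq
      rw [heq]
      abel

/-! ### The piece-length profile of a diagram and the sum over compositions -/

/-- Extension by zero of a tuple `Fin (M+1) → ℕ` to `ℕ → ℕ`. [folklore] -/
def extTuple {M : ℕ} (k : Fin (M + 1) → ℕ) (j : ℕ) : ℕ := if h : j < M + 1 then k ⟨j, h⟩ else 0

/-- Partial sums `k_0 + ⋯ + k_i` of a tuple (the lace times of the profile). [folklore] -/
def partialSum {M : ℕ} (k : Fin (M + 1) → ℕ) (i : ℕ) : ℕ := ∑ j ∈ Finset.range (i + 1), extTuple k j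

/-- `partialSum k 0 = k 0`. [folklore] -/
theorem partialSum_zero {M : ℕ} (k : Fin (M + 1) → ℕ) : partialSum k 0 = extTuple k 0 := by
  simp [partialSum]

/-- `partialSum k (i+1) = partialSum k i + k (i+1)`. [folklore] -/
theorem partialSum_succ {M : ℕ} (k : Fin (M + 1) → ℕ) (i : ℕ) :
    partialSum k (i + 1) = partialSum k i + extTuple k (i + 1) := by
  rw [partialSum, Finset.sum_range_succ]; rfl

/-- The factors of `card_profSet_le` for the profile `t = partialSum k`: `t 0 = k 0`,
`t (i+1) - t i = k (i+1)` and `t i + 1 - prevT t i = k i + 1`. [folklore] -/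
theorem partialSum_sub (M : ℕ) (k : Fin (M + 1) → ℕ) (i : ℕ) :
    partialSum k (i + 1) - partialSum k i = extTuple k (i + 1) ∧
      partialSum k i + 1 - prevT (partialSum k) i = extTuple k i + 1 := by
  refine ⟨by rw [partialSum_succ, Nat.add_sub_cancel_left], ?_⟩
  rcases i with _ | i
  · rw [prevT_zero, partialSum_zero]; rfl
  · rw [prevT_succ, partialSum_succ]; omega

/-- `Σ_{i ≤ M} k_i = partialSum k M`. [folklore] -/
theorem sum_univ_eq_partialSum {M : ℕ} (k : Fin (M + 1) → ℕ) : ∑ i, k i = partialSum k M := by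
  rw [partialSum, Finset.sum_range (fun j => extTuple k j)]
  refine Finset.sum_congr rfl fun i _ => ?_
  simp [extTuple, i.isLt]

/-- The piece lengths `k_i = T_i - T_{i-1}` (`k_0 = T_0`) of a diagram of order `M + 1`.
[cite: Slade2006LaceExpansion, §3.1] -/
def pieceLen {a : ℕ} (σ : StepSeq d a) (M : ℕ) : Fin (M + 1) → ℕ :=
  fun i => laceTime σ i - (if (i : ℕ) = 0 then 0 else laceTime σ (i - 1))

/-- **Telescoping**: the lace times of a diagram are the partial sums of its piece lengths,
`T_i = k_0 + ⋯ + k_i` for `i ≤ M`. [folklore] -/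
theorem laceTime_eq_partialSum {a M : ℕ} (σ : StepSeq d a) :
    ∀ i ≤ M, laceTime σ i = partialSum (pieceLen σ M) i := by
  intro i
  induction i with
  | zero =>
    intro _
    rw [partialSum_zero, extTuple, dif_pos (Nat.succ_pos M)]
    simp [pieceLen]
  | succ i ih =>
    intro hi
    rw [partialSum_succ, ← ih (Nat.le_of_succ_le hi), extTuple, dif_pos (Nat.lt_succ_of_le hi)]
    simp only [pieceLen, Nat.succ_ne_zero, ↓reduceIte, Nat.add_sub_cancel]
    have := laceTime_le_succ σ i
    omega

/-- The piece lengths of an `a`-step diagram with `T_M = a` form a composition of `a`.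
[folklore] -/
theorem pieceLen_mem_antidiagonalTuple {a M : ℕ} {σ : StepSeq d a} (hT : laceTime σ M = a) :
    pieceLen σ M ∈ Finset.Nat.antidiagonalTuple (M + 1) a := by
  rw [Finset.Nat.mem_antidiagonalTuple, sum_univ_eq_partialSum, ← laceTime_eq_partialSum σ M le_rfl, hT]

/-- **Lemma 7, combinatorial form**: for any `Q` with `c_k^{(0)}(x) ≤ Q k`,
`Σ_x π_a^{(M+1)}(x) ≤ Σ_{k_0+⋯+k_M = a} c_{k_0}^{(0)}(0) · ∏_{i<M} (k_i + 1) · Q(k_{i+1})`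
(Graham: "`π̂_a^{(N)}(0;τ) ≤ [β^a](F_β^τ)^N`" with `F_β^τ = Σ_k β^k sup_x k c_k^{(0)}(x)`; here at
infinite memory, with `k + 1` for the `k + 1` sites of a piece of length `k`, and a genuine loop
count for the first piece). [cite: Graham2010, Lemma 7] -/
theorem diagTotal_le_sum_antidiagonalTuple {Q : ℕ → ℕ} (hQ : ∀ k (x : Site d), SRW.count d k x ≤ Q k)
    (a M : ℕ) :
    diagTotal d a M ≤ ∑ k ∈ Finset.Nat.antidiagonalTuple (M + 1) a,
      SRW.count d (extTuple k 0) 0 * ∏ i ∈ Finset.range M, ((extTuple k i + 1) * Q (extTuple k (i + 1))) := by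
  classical
  -- cover the diagrams by their profiles
  have hcover : (Finset.univ.filter fun σ : StepSeq d a => IsDiag σ M ∧ laceTime σ M = a) ⊆
      (Finset.Nat.antidiagonalTuple (M + 1) a).biUnion fun k => profSet d a M (partialSum k) := by
    intro σ hσ
    rw [Finset.mem_filter] at hσ
    obtain ⟨-, hD, hT⟩ := hσ
    rw [Finset.mem_biUnion]
    refine ⟨pieceLen σ M, pieceLen_mem_antidiagonalTuple hT, ?_⟩
    unfold profSet
    rw [Finset.mem_filter]
    exact ⟨Finset.mem_univ _, hD, laceTime_eq_partialSum σ⟩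
  calc diagTotal d a M
      ≤ ((Finset.Nat.antidiagonalTuple (M + 1) a).biUnion fun k => profSet d a M (partialSum k)).card := by
        unfold diagTotal; exact Finset.card_le_card hcover
    _ ≤ ∑ k ∈ Finset.Nat.antidiagonalTuple (M + 1) a, (profSet d a M (partialSum k)).card :=
        Finset.card_biUnion_le
    _ ≤ ∑ k ∈ Finset.Nat.antidiagonalTuple (M + 1) a,
          SRW.count d (extTuple k 0) 0 * ∏ i ∈ Finset.range M, ((extTuple k i + 1) * Q (extTuple k (i + 1))) := by
        refine Finset.sum_le_sum fun k hk => ?_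
        have hsum : partialSum k M = a := by
          rw [← sum_univ_eq_partialSum]; exact (Finset.Nat.mem_antidiagonalTuple.1 hk)
        refine (card_profSet_le hQ (partialSum k) M a hsum).trans (le_of_eq ?_)
        rw [partialSum_zero]
        congr 1
        refine Finset.prod_congr rfl fun i _ => ?_
        rw [(partialSum_sub M k i).1, (partialSum_sub M k i).2]

/-! ### From compositions to the coefficient `[β^a] F(β)^N` -/

/-- Every piece of a diagram with `T_M = a` has positive length: `k_0 = T_0 ≥ 2` and
`k_i = T_i - T_{i-1} ≥ 1`. [folklore] -/
theorem one_le_pieceLen {a M : ℕ} {σ : StepSeq d a} (hT : laceTime σ M = a) (i : Fin (M + 1)) :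
    1 ≤ pieceLen σ M i := by
  have hi : (i : ℕ) ≤ M := Nat.lt_succ_iff.1 i.isLt
  have hle : laceTime σ i ≤ a := (laceTime_mono σ hi).trans hT.le
  unfold pieceLen
  rcases Nat.eq_zero_or_pos (i : ℕ) with h0 | hpos
  · rw [if_pos h0, h0]
    have := two_le_laceTime_zero (by rw [h0] at hle; exact hle)
    omega
  · rw [if_neg (by omega)]
    obtain ⟨j, hj⟩ : ∃ j, (i : ℕ) = j + 1 := ⟨i - 1, by omega⟩
    rw [hj] at hle ⊢
    have h1 := (laceTime_spec hle).1
    rw [laceStart_succ] at h1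
    simp only [Nat.add_sub_cancel]
    omega

/-- **Coefficient extraction**: `Σ_{k_0+⋯+k_{N} = a} ∏ᵢ g(kᵢ) = [s^a] G(s)^{N+1}` for
`G(s) = Σ_k g(k) s^k`, i.e. `= cpow g (N+1) a` (`BDGS2012GrahamReversion.lean`). [folklore] -/
theorem sum_antidiagonalTuple_prod_eq_cpow (g : ℕ → ℝ) :
    ∀ N a : ℕ, ∑ k ∈ Finset.Nat.antidiagonalTuple (N + 1) a, ∏ i, g (k i) = cpow g (N + 1) a := by
  intro N
  induction N with
  | zero =>
    intro a
    rw [Finset.Nat.antidiagonalTuple_one, Finset.sum_singleton, cpow_one]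
    simp
  | succ N ih =>
    intro a
    rw [cpow_succ]
    simp_rw [← ih, Finset.sum_mul]
    -- `k ↦ (j, init k)` with `j = a - k (last)`, inverse `(j, y) ↦ snoc y (a - j)`
    rw [Finset.sum_sigma' (Finset.range (a + 1)) (fun j => Finset.Nat.antidiagonalTuple (N + 1) j)
      (fun j y => (∏ i, g (y i)) * g (a - j))]
    refine Finset.sum_nbij' (fun k => ⟨∑ i : Fin (N + 1), k i.castSucc, Fin.init k⟩)
      (fun p => Fin.snoc p.2 (a - p.1)) ?_ ?_ ?_ ?_ ?_
    · intro k hk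
      rw [Finset.Nat.mem_antidiagonalTuple, Fin.sum_univ_castSucc] at hk
      simp only [Finset.mem_sigma, Finset.mem_range, Finset.Nat.mem_antidiagonalTuple]
      exact ⟨by omega, rfl⟩
    · rintro ⟨j, y⟩ hp
      simp only [Finset.mem_sigma, Finset.mem_range, Finset.Nat.mem_antidiagonalTuple] at hp
      rw [Finset.Nat.mem_antidiagonalTuple, Fin.sum_univ_castSucc]
      simp only [Fin.snoc_castSucc, Fin.snoc_last]
      omega
    · intro k hk
      rw [Finset.Nat.mem_antidiagonalTuple, Fin.sum_univ_castSucc] at hk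
      dsimp only
      have : a - ∑ i : Fin (N + 1), k i.castSucc = k (Fin.last (N + 1)) := by omega
      rw [this]
      exact Fin.snoc_init_self _
    · rintro ⟨j, y⟩ hp
      simp only [Finset.mem_sigma, Finset.mem_range, Finset.Nat.mem_antidiagonalTuple] at hp
      simp only [Fin.snoc_castSucc, Fin.init_snoc, Sigma.mk.inj_iff, heq_eq_eq, and_true]
      omega
    · intro k hk
      dsimp only
      rw [Fin.prod_univ_castSucc]
      congr 2
      rw [Finset.Nat.mem_antidiagonalTuple, Fin.sum_univ_castSucc] at hk
      omega

open Classical in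
/-- The lace graphs of order `M + 1` and length `a` all of whose pieces have length `≤ K`
(Graham's memory-`τ` restriction appears at infinite memory as this truncation of the piece
lengths; the complementary class, with a piece longer than `K`, is estimated separately).
[cite: Graham2010, Section 6 (the split of `Π̂` into `A₂, A₃, A₄`)] -/
def diagTotalLe (d a M K : ℕ) : ℕ :=
  (Finset.univ.filter fun σ : StepSeq d a =>
    (IsDiag σ M ∧ laceTime σ M = a) ∧ ∀ i : Fin (M + 1), pieceLen σ M i ≤ K).card

open Classical in
/-- The lace graphs of order `M + 1` and length `a` with some piece longer than `K`.
[cite: Graham2010, Section 6] -/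
def diagTotalGt (d a M K : ℕ) : ℕ :=
  (Finset.univ.filter fun σ : StepSeq d a =>
    (IsDiag σ M ∧ laceTime σ M = a) ∧ ¬ ∀ i : Fin (M + 1), pieceLen σ M i ≤ K).card

/-- `Σ_x π_a^{(M+1)}(x) = diagTotalLe + diagTotalGt` (partition by the longest piece). [folklore] -/
theorem diagTotal_eq_add (d a M K : ℕ) : diagTotal d a M = diagTotalLe d a M K + diagTotalGt d a M K := by
  classical
  unfold diagTotal diagTotalLe diagTotalGt
  rw [← Finset.card_filter_add_card_filter_not
    (p := fun σ : StepSeq d a => ∀ i : Fin (M + 1), pieceLen σ M i ≤ K), Finset.filter_filter,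
    Finset.filter_filter]

/-- **Lemma 7 as a coefficient bound**: for `z ≥ 0` and any `Q` with `c_k^{(0)}(x) ≤ Q k`, the
lace graphs of length `a` with all pieces of length `≤ K` satisfy
`z^a · #{⋯} ≤ [β^a] F(β)^{M+1}` with `F(β) = Σ_{k=1}^{K} (k+1) Q(k) (zβ)^k`, i.e.
`≤ cpow f (M+1) a` with `f k = (k+1) Q(k) z^k` for `1 ≤ k ≤ K` and `0` otherwise (Graham:
"`π̂_a^{(N)}(0;τ) ≤ [β^a](F_β^τ)^N`, `F_β^τ = Σ_{k=1}^{τ} β^k sup_x k c_k^{(0)}(x)`").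
[cite: Graham2010, Lemma 7] -/
theorem diagTotalLe_mul_pow_le_cpow {Q : ℕ → ℕ} (hQ : ∀ k (x : Site d), SRW.count d k x ≤ Q k)
    {z : ℝ} (hz : 0 ≤ z) (a M K : ℕ) :
    (diagTotalLe d a M K : ℝ) * z ^ a ≤
      cpow (fun k => if k = 0 ∨ K < k then 0 else ((k : ℝ) + 1) * (Q k : ℝ) * z ^ k) (M + 1) a := by
  classical
  set f : ℕ → ℝ := fun k => if k = 0 ∨ K < k then 0 else ((k : ℝ) + 1) * (Q k : ℝ) * z ^ k with hf
  have hf0 : ∀ k, 0 ≤ f k := by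
    intro k; simp only [hf]; split_ifs <;> positivity
  -- cover by positive, `K`-bounded profiles
  have hcover : (Finset.univ.filter fun σ : StepSeq d a =>
      (IsDiag σ M ∧ laceTime σ M = a) ∧ ∀ i : Fin (M + 1), pieceLen σ M i ≤ K) ⊆
      ((Finset.Nat.antidiagonalTuple (M + 1) a).filter fun k => ∀ i, 1 ≤ k i ∧ k i ≤ K).biUnion
        fun k => profSet d a M (partialSum k) := by
    intro σ hσ
    rw [Finset.mem_filter] at hσ
    obtain ⟨-, ⟨hD, hT⟩, hK⟩ := hσ
    rw [Finset.mem_biUnion]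
    refine ⟨pieceLen σ M, Finset.mem_filter.2 ⟨pieceLen_mem_antidiagonalTuple hT,
      fun i => ⟨one_le_pieceLen hT i, hK i⟩⟩, ?_⟩
    unfold profSet
    rw [Finset.mem_filter]
    exact ⟨Finset.mem_univ _, hD, laceTime_eq_partialSum σ⟩
  -- the counting bound per admissible profile, folded into `∏ (k_i + 1) Q(k_i)`
  have hprof : ∀ k ∈ (Finset.Nat.antidiagonalTuple (M + 1) a).filter (fun k => ∀ i, 1 ≤ k i ∧ k i ≤ K),
      ((profSet d a M (partialSum k)).card : ℝ) * z ^ a ≤ ∏ i, f (k i) := by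
    intro k hk
    rw [Finset.mem_filter, Finset.Nat.mem_antidiagonalTuple] at hk
    obtain ⟨hsum, hpos⟩ := hk
    have hsum' : partialSum k M = a := by rw [← sum_univ_eq_partialSum]; exact hsum
    have h1 := card_profSet_le hQ (partialSum k) M a hsum'
    rw [partialSum_zero] at h1
    have h1' : (profSet d a M (partialSum k)).card ≤
        Q (extTuple k 0) * ∏ i ∈ Finset.range M, ((extTuple k i + 1) * Q (extTuple k (i + 1))) := by
      refine h1.trans ?_
      refine Nat.mul_le_mul_right _ (hQ _ _) |>.trans (le_of_eq ?_)
      congr 1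
      exact Finset.prod_congr rfl fun i _ => by rw [(partialSum_sub M k i).1, (partialSum_sub M k i).2]
    -- `Q(k_0) ∏_{i<M} (k_i+1) Q(k_{i+1}) ≤ ∏_{i ≤ M} (k_i + 1) Q(k_i)` (ratio `k_M + 1 ≥ 1`)
    have h2 : Q (extTuple k 0) * ∏ i ∈ Finset.range M, ((extTuple k i + 1) * Q (extTuple k (i + 1))) ≤
        ∏ i ∈ Finset.range (M + 1), ((extTuple k i + 1) * Q (extTuple k i)) := by
      have eL : Q (extTuple k 0) * ∏ i ∈ Finset.range M, ((extTuple k i + 1) * Q (extTuple k (i + 1))) =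
          (∏ i ∈ Finset.range M, (extTuple k i + 1)) * ∏ i ∈ Finset.range (M + 1), Q (extTuple k i) := by
        rw [Finset.prod_mul_distrib, Finset.prod_range_succ' (fun i => Q (extTuple k i))]
        ring
      have eR : ∏ i ∈ Finset.range (M + 1), ((extTuple k i + 1) * Q (extTuple k i)) =
          (∏ i ∈ Finset.range (M + 1), (extTuple k i + 1)) * ∏ i ∈ Finset.range (M + 1), Q (extTuple k i) :=
        Finset.prod_mul_distrib
      rw [eL, eR]
      refine Nat.mul_le_mul_right _ ?_
      rw [Finset.prod_range_succ]
      exact Nat.le_mul_of_pos_right _ (Nat.succ_pos _)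
    -- `∏_{i<M+1} w(extTuple k i) · z^a = ∏_{i : Fin (M+1)} f (k i)`
    have h3 : ((∏ i ∈ Finset.range (M + 1), ((extTuple k i + 1) * Q (extTuple k i)) : ℕ) : ℝ) * z ^ a =
        ∏ i : Fin (M + 1), f (k i) := by
      rw [Finset.prod_range (fun i => (extTuple k i + 1) * Q (extTuple k i)), ← hsum, ← Finset.prod_pow_eq_pow_sum,
        Nat.cast_prod, ← Finset.prod_mul_distrib]
      refine Finset.prod_congr rfl fun i _ => ?_
      have hki : extTuple k i = k i := by simp [extTuple, i.isLt]
      rw [hki, hf]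
      simp only
      rw [if_neg (by have := hpos i; omega)]
      push_cast
      ring
    calc ((profSet d a M (partialSum k)).card : ℝ) * z ^ a
        ≤ ((∏ i ∈ Finset.range (M + 1), ((extTuple k i + 1) * Q (extTuple k i)) : ℕ) : ℝ) * z ^ a := by
          have := h1'.trans h2
          exact mul_le_mul_of_nonneg_right (by exact_mod_cast this) (by positivity)
      _ = ∏ i, f (k i) := h3
  -- assemble
  rw [← sum_antidiagonalTuple_prod_eq_cpow]
  calc (diagTotalLe d a M K : ℝ) * z ^ a
      ≤ ((((Finset.Nat.antidiagonalTuple (M + 1) a).filter fun k => ∀ i, 1 ≤ k i ∧ k i ≤ K).biUnion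
          fun k => profSet d a M (partialSum k)).card : ℝ) * z ^ a := by
        refine mul_le_mul_of_nonneg_right ?_ (by positivity)
        unfold diagTotalLe
        exact_mod_cast Finset.card_le_card hcover
    _ ≤ (∑ k ∈ (Finset.Nat.antidiagonalTuple (M + 1) a).filter (fun k => ∀ i, 1 ≤ k i ∧ k i ≤ K),
          ((profSet d a M (partialSum k)).card : ℝ)) * z ^ a := by
        refine mul_le_mul_of_nonneg_right ?_ (by positivity)
        exact_mod_cast Finset.card_biUnion_le
    _ = ∑ k ∈ (Finset.Nat.antidiagonalTuple (M + 1) a).filter (fun k => ∀ i, 1 ≤ k i ∧ k i ≤ K),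
          ((profSet d a M (partialSum k)).card : ℝ) * z ^ a := Finset.sum_mul _ _ _
    _ ≤ ∑ k ∈ (Finset.Nat.antidiagonalTuple (M + 1) a).filter (fun k => ∀ i, 1 ≤ k i ∧ k i ≤ K),
          ∏ i, f (k i) := Finset.sum_le_sum hprof
    _ ≤ ∑ k ∈ Finset.Nat.antidiagonalTuple (M + 1) a, ∏ i, f (k i) :=
        Finset.sum_le_sum_of_subset_of_nonneg (Finset.filter_subset _ _) fun k _ _ =>
          Finset.prod_nonneg fun i _ => hf0 _

end Literature.Probability.RandomPlanarGeometry.SAW.Zd.Graham2010
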